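import Mathlib
import HarnessLib
import Literature.Analysis.FluidPDE.VectorCalculus
import Literature.Analysis.FluidPDE.SphereIntegral
import Summits.NavierStokesRegularity.NavierStokesRegularity.Theorems.UnthreadedDoorAntidynamoWallOfSphereMeanEngine
import Summits.NavierStokesRegularity.NavierStokesRegularity.Theorems.UnthreadedDoorAntidynamoWallSubsolutionHalfball

/-!
# Route `UnthreadedDoor` / `ThreadingFlux`, crux `PoloidalLiouville` (stmt-NavierStokesRegularity-1222), antidynamo v2 skeleton
# (sha16 `4ebf5683127b`), WALL `stub_scalarLiouville`: THE WALL FROM A ONE-SIDED (SUBSOLUTION) ENGINE IN THE SPHERICAL-MEAN GAUGE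

Support file (seat leafhand-ns-unthreadeddoor-2 g5, cell decomp-ns), `--supports stmt-NavierStokesRegularity-1222 --as helper`; theorems only.

`…WallOfSphereMeanEngine` / `…WallIffSphereMeanEngine` certify WALL ⟺ ENGINE, ENGINE asking the spherical-mean deviation `F = T − T̄` to be
an EXACT solution of a drift–diffusion law (class of `KNSS2009_lemma21_halfball`).  Because `F` has ZERO MEAN on every sphere about `x₀`,
`F ≤ 0` already forces `F ≡ 0`; so a ONE-SIDED engine suffices.  With Lemma 2.1 for subsolutions (`DriftHeatSub.halfball_of_subsolution`,
this seat) and the obstruction `ShellMean.not_halfballs_sphereMean`: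

* ★ `nonpos_of_sphereMeanSubEngine` — a jointly continuous `f` with `C²` slices, bounded jointly continuous `∇f, Δf`, satisfying the
  SUBsolution law `f(t) − f(s) ≤ ∫ₛᵗ (Δf − Df·a)` (`a` bounded measurable), bounded, and equal off the centre to `T − T̄(‖· − x₀‖)`, is `≤ 0`;
* ★ `sphereMean_deviation_eq_zero_of_nonpos` — a continuous function whose spherical-mean deviation is `≤ 0` on a sphere has deviation `0`
  there (zero mean + sign + continuity + open-positivity of `volume.toSphere`);
* ★★ `stubScalarLiouville_of_sphereMeanSubEngine` — **WALL ⟸ SUB-ENGINE**: if for every `(v, x₀, T)` with the binders of `StubScalarLiouville`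
  the deviation `T − T̄` extends to such a subsolution `f`, then `StubScalarLiouville`.

WHAT THE SUB-ENGINE ASKS, CONCRETELY (`…WallPotentialLawTangential`): a bounded measurable `a` with
`−(∂ᵣP − ⨍_{S_r}∂ᵣP)/r + ⨍_{S_r}⟪v_tan, ∇_S T⟫ ≤ ⟪a − v_tan, ∇F⟫` on the slab — a ONE-SIDED domination of the mean-gauge forcing along `∇F`
(at critical points of `F`: a SIGN condition on the head's radial derivative against its spherical mean).  This is the research content; it is
NOT claimed.  HONEST LABEL: bookkeeping; nothing here proves `stub_scalarLiouville`, `PoloidalLiouville` (1222) or bears on Navier–Stokes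
regularity; no summit statement is proved. [cite: KochNadirashviliSereginSverak2009, Lemma 2.1 and proof of Thm 5.2 (arXiv:0709.3599 pp. 5, 10)]
-/

noncomputable section

-- the summit and its single sub-problem share the name (CONVENTIONS §1)
set_option linter.dupNamespace false

open scoped Topology InnerProductSpace RealInnerProductSpace ContDiff Laplacian
open Filter Set Function Metric MeasureTheory intervalIntegral
open Literature.Analysis.FluidPDE

namespace Summit.NavierStokesRegularity.NavierStokesRegularity.Theorems.PoloidalLiouville.Antidynamo

namespace ShellMean

/-! ### §17 SUB-ENGINE + OBSTRUCTION ⇒ the deviation is `≤ 0` -/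

/-- ★ **Sub-engine + obstruction ⇒ `f ≤ 0`.** [cite: KochNadirashviliSereginSverak2009, proof of Thm 5.2 (arXiv p. 10) — one-sided variant] -/
theorem nonpos_of_sphereMeanSubEngine
    {v : ℝ → EuclideanSpace ℝ (Fin 3) → EuclideanSpace ℝ (Fin 3)} {x₀ : EuclideanSpace ℝ (Fin 3)}
    {T : ℝ → EuclideanSpace ℝ (Fin 3) → ℝ} {V : ℝ}
    (hsm : ContDiffOn ℝ (⊤ : ℕ∞) (Function.uncurry v) (Set.Iio 0 ×ˢ Set.univ))
    (hsT : ContDiffOn ℝ (⊤ : ℕ∞) (Function.uncurry T) (Set.Iio 0 ×ˢ ({x₀}ᶜ : Set (EuclideanSpace ℝ (Fin 3)))))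
    (hV : ∀ t < 0, ∀ x, ‖v t x‖ ≤ V)
    (hrep : ∀ t < 0, ∀ x, curl (v t) x = cross (gradient (T t) x) (x - x₀))
    {f : ℝ → EuclideanSpace ℝ (Fin 3) → ℝ} {a : ℝ → EuclideanSpace ℝ (Fin 3) → EuclideanSpace ℝ (Fin 3)} {A : ℝ}
    (hfT : ∀ t < 0, ∀ y, y ≠ x₀ → f t y = T t y -
      sphereIntegral volume (fun z => T t (x₀ + z)) ‖y - x₀‖ / ((volume : Measure (EuclideanSpace ℝ (Fin 3))).toSphere).real univ)
    (ha : Measurable (uncurry a)) (haA : ∀ t < 0, ∀ y, ‖a t y‖ ≤ A)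
    (hfb : ∃ C : ℝ, ∀ t < 0, ∀ y, |f t y| ≤ C) (hf2 : ∀ t < 0, ContDiff ℝ 2 (f t))
    (hfD : ∃ C : ℝ, ∀ t < 0, ∀ y, ‖fderiv ℝ (f t) y‖ ≤ C ∧ |(Δ (f t)) y| ≤ C)
    (hcD : ContinuousOn (fun p : ℝ × EuclideanSpace ℝ (Fin 3) => fderiv ℝ (f p.1) p.2) (Iio 0 ×ˢ univ))
    (hcΔ : ContinuousOn (fun p : ℝ × EuclideanSpace ℝ (Fin 3) => (Δ (f p.1)) p.2) (Iio 0 ×ˢ univ))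
    (hfc : ContinuousOn (uncurry f) (Iio 0 ×ˢ univ))
    (hsub : ∀ y, ∀ s t : ℝ, s ≤ t → t < 0 →
      f t y - f s y ≤ ∫ τ in s..t, ((Δ (f τ)) y - fderiv ℝ (f τ) y (a τ y))) :
    ∀ t < 0, ∀ y, f t y ≤ 0 := by
  obtain ⟨M₁, hM, happ, hdich⟩ := sSup_engine_pack hfb
  intro t ht y
  rcases hdich t ht y with h | hM₁
  · exact h
  · exfalso
    have hballs := DriftHeatSub.halfball_of_subsolution ha haA hf2 hfD hcD hcΔ hfc hsub hM happ hM₁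
    refine not_halfballs_sphereMean hsm hsT hV hrep hM₁ fun R hR => ?_
    obtain ⟨y₀, t₀, ht₀, hb⟩ := hballs R hR
    refine ⟨y₀, t₀, ht₀, fun s hs z hz hzx => ?_⟩
    have hs0 : s < 0 := lt_trans hs.2 ht₀
    rw [← hfT s hs0 z hzx]
    exact hb s hs z hz

/-! ### §18 Zero mean + sign ⇒ zero -/

/-- ★ **A continuous spherical-mean deviation that is `≤ 0` on a sphere vanishes there**: for `T` continuous off `x₀` and `r ≠ 0`, if
`T(x₀ + rα) − T̄(r) ≤ 0` for all `α ∈ S²` then `T(x₀ + rα) = T̄(r)` for all `α` (`volume.toSphere` is positive on open sets). [folklore] -/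
theorem sphereMean_deviation_eq_zero_of_nonpos {T : EuclideanSpace ℝ (Fin 3) → ℝ} {x₀ : EuclideanSpace ℝ (Fin 3)} {r : ℝ}
    (hTc : ContinuousOn T {x₀}ᶜ) (hr : r ≠ 0)
    (hle : ∀ α : sphere (0 : EuclideanSpace ℝ (Fin 3)) 1, T (x₀ + r • (α : EuclideanSpace ℝ (Fin 3))) -
      sphereIntegral volume (fun z => T (x₀ + z)) r / ((volume : Measure (EuclideanSpace ℝ (Fin 3))).toSphere).real univ ≤ 0) :
    ∀ α : sphere (0 : EuclideanSpace ℝ (Fin 3)) 1, T (x₀ + r • (α : EuclideanSpace ℝ (Fin 3))) =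
      sphereIntegral volume (fun z => T (x₀ + z)) r / ((volume : Measure (EuclideanSpace ℝ (Fin 3))).toSphere).real univ := by
  set σ : Measure (sphere (0 : EuclideanSpace ℝ (Fin 3)) 1) :=
    (volume : Measure (EuclideanSpace ℝ (Fin 3))).toSphere with hσ
  set cst : ℝ := sphereIntegral volume (fun z => T (x₀ + z)) r / σ.real univ with hcst
  have hσpos : 0 < σ.real univ := toSphere_real_univ_pos
  -- the nonnegative continuous function `g = cst − T(x₀ + r·)` has zero integral
  set g : sphere (0 : EuclideanSpace ℝ (Fin 3)) 1 → ℝ :=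
    fun α => cst - T (x₀ + r • (α : EuclideanSpace ℝ (Fin 3))) with hg
  have hgc : Continuous g := continuous_const.sub (continuous_sphere_slice hTc hr)
  have hgi : Integrable g σ := integrable_toSphere_of_continuous hgc
  have hg0 : 0 ≤ g := fun α => by simp only [hg, Pi.zero_apply]; linarith [hle α]
  have hTi : Integrable (fun α : sphere (0 : EuclideanSpace ℝ (Fin 3)) 1 =>
      T (x₀ + r • (α : EuclideanSpace ℝ (Fin 3)))) σ :=
    integrable_toSphere_of_continuous (continuous_sphere_slice hTc hr)
  have hint : ∫ α, g α ∂σ = 0 := by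
    simp only [hg]
    rw [integral_sub (integrable_const _) hTi, MeasureTheory.integral_const, smul_eq_mul, ← sphereIntegral_translate, hcst,
      mul_div_cancel₀ _ hσpos.ne', sub_self]
  have hae : g =ᵐ[σ] 0 := (integral_eq_zero_iff_of_nonneg hg0 hgi).mp hint
  have hzero : g = 0 := (Continuous.ae_eq_iff_eq σ hgc continuous_const).mp hae
  intro α
  have := congrArg (fun h => h α) hzero
  simp only [hg, Pi.zero_apply] at this
  linarith

/-! ### §19 WALL ⟸ SUB-ENGINE (spherical-mean gauge), by name -/

/-- ★★ **WALL ⟸ SUB-ENGINE.**  If for every `(v, x₀, T)` carrying the binders of `StubScalarLiouville` the spherical-mean deviation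
`T(t,y) − T̄(t,‖y − x₀‖)` extends to a jointly continuous SUBsolution `f` (`f(t) − f(s) ≤ ∫ₛᵗ (Δf − Df·a)`, `a` bounded measurable) in the
elementary class, then `StubScalarLiouville` holds: `f ≤ 0` (★), so the zero-mean deviation vanishes on every sphere, `T(t,·)` is constant
on spheres, and `∇T × (x − x₀) = 0`.  The sub-engine is NOT claimed (module docstring). [cite: KochNadirashviliSereginSverak2009, proof of Thm 5.2 (arXiv p. 10)] -/
theorem stubScalarLiouville_of_sphereMeanSubEngine
    (hE : ∀ (v : ℝ → EuclideanSpace ℝ (Fin 3) → EuclideanSpace ℝ (Fin 3)) (x₀ : EuclideanSpace ℝ (Fin 3))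
      (T : ℝ → EuclideanSpace ℝ (Fin 3) → ℝ),
      Literature.Analysis.FluidPDE.IsBoundedAncientMildSolution 1 v →
      (∀ t < 0, AEStronglyMeasurable (v t) volume) →
      ContDiffOn ℝ (⊤ : ℕ∞) (Function.uncurry v) (Set.Iio 0 ×ˢ Set.univ) →
      ContDiffOn ℝ (⊤ : ℕ∞) (Function.uncurry T) (Set.Iio 0 ×ˢ ({x₀}ᶜ : Set (EuclideanSpace ℝ (Fin 3)))) →
      (∃ C : ℝ, ∀ t < 0, ∀ x, |T t x| ≤ C) →
      (∀ t < 0, ∀ x, curl (v t) x = cross (gradient (T t) x) (x - x₀)) →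
      (∀ t < 0, ∀ x, x ≠ x₀ →
        cross (gradient (fun z => deriv (fun s => T s z) t + inner ℝ (v t z) (gradient (T t) z)
              - Laplacian.laplacian (T t) z) x) (x - x₀) =
          cross (gradient (fun z => inner ℝ (v t z) (z - x₀)) x) (gradient (T t) x)) →
      ∃ (f : ℝ → EuclideanSpace ℝ (Fin 3) → ℝ) (a : ℝ → EuclideanSpace ℝ (Fin 3) → EuclideanSpace ℝ (Fin 3)) (A : ℝ),
        (∀ t < 0, ∀ y, y ≠ x₀ → f t y = T t y -
          sphereIntegral volume (fun z => T t (x₀ + z)) ‖y - x₀‖ /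
            ((volume : Measure (EuclideanSpace ℝ (Fin 3))).toSphere).real univ) ∧
        Measurable (uncurry a) ∧ (∀ t < 0, ∀ y, ‖a t y‖ ≤ A) ∧
        (∃ C : ℝ, ∀ t < 0, ∀ y, |f t y| ≤ C) ∧ (∀ t < 0, ContDiff ℝ 2 (f t)) ∧
        (∃ C : ℝ, ∀ t < 0, ∀ y, ‖fderiv ℝ (f t) y‖ ≤ C ∧ |(Δ (f t)) y| ≤ C) ∧
        ContinuousOn (fun p : ℝ × EuclideanSpace ℝ (Fin 3) => fderiv ℝ (f p.1) p.2) (Iio 0 ×ˢ univ) ∧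
        ContinuousOn (fun p : ℝ × EuclideanSpace ℝ (Fin 3) => (Δ (f p.1)) p.2) (Iio 0 ×ˢ univ) ∧
        ContinuousOn (uncurry f) (Iio 0 ×ˢ univ) ∧
        (∀ y, ∀ s t : ℝ, s ≤ t → t < 0 →
          f t y - f s y ≤ ∫ τ in s..t, ((Δ (f τ)) y - fderiv ℝ (f τ) y (a τ y)))) :
    StubScalarLiouville := by
  intro v x₀ T hB hm hsm hsT hTb hrep hE1 t ht x
  obtain ⟨V, hVb⟩ := hB.2
  have hV : ∀ s < 0, ∀ y, ‖v s y‖ ≤ V := fun s hs y => hVb s hs y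
  obtain ⟨f, a, A, hfT, ha, haA, hfb, hf2, hfD, hcD, hcΔ, hfc, hsub⟩ := hE v x₀ T hB hm hsm hsT hTb hrep hE1
  have hle : ∀ s < 0, ∀ y, f s y ≤ 0 :=
    nonpos_of_sphereMeanSubEngine hsm hsT hV hrep hfT ha haA hfb hf2 hfD hcD hcΔ hfc hsub
  -- slice regularity at time `t`
  have hO : IsOpen (({x₀}ᶜ : Set (EuclideanSpace ℝ (Fin 3)))) := isOpen_compl_singleton
  have hι : ContDiff ℝ (⊤ : ℕ∞) fun y : EuclideanSpace ℝ (Fin 3) => (t, y) := contDiff_prodMk_right t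
  have hTt : ContDiffOn ℝ (⊤ : ℕ∞) (T t) ({x₀}ᶜ) := hsT.comp hι.contDiffOn fun y hy => ⟨ht, hy⟩
  have hTd : ∀ y, y ≠ x₀ → DifferentiableAt ℝ (T t) y := fun y hy =>
    (hTt.contDiffAt (hO.mem_nhds hy)).differentiableAt (by simp)
  -- the deviation vanishes off the centre
  have hzero : ∀ y, y ≠ x₀ → T t y =
      (fun r : ℝ => sphereIntegral volume (fun z => T t (x₀ + z)) r /
        ((volume : Measure (EuclideanSpace ℝ (Fin 3))).toSphere).real univ) ‖y - x₀‖ := by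
    intro y hy
    have hr : ‖y - x₀‖ ≠ 0 := norm_ne_zero_iff.mpr (sub_ne_zero.mpr hy)
    -- on the sphere of radius `‖y − x₀‖` the deviation is `≤ 0`, hence `= 0`
    have hleS : ∀ α : sphere (0 : EuclideanSpace ℝ (Fin 3)) 1,
        T t (x₀ + ‖y - x₀‖ • (α : EuclideanSpace ℝ (Fin 3))) -
          sphereIntegral volume (fun z => T t (x₀ + z)) ‖y - x₀‖ /
            ((volume : Measure (EuclideanSpace ℝ (Fin 3))).toSphere).real univ ≤ 0 := by
      intro α
      have hne : x₀ + ‖y - x₀‖ • (α : EuclideanSpace ℝ (Fin 3)) ≠ x₀ := centre_add_smul_sphere_ne α hr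
      have h := hle t ht (x₀ + ‖y - x₀‖ • (α : EuclideanSpace ℝ (Fin 3)))
      have hnorm : ‖x₀ + ‖y - x₀‖ • (α : EuclideanSpace ℝ (Fin 3)) - x₀‖ = ‖y - x₀‖ := by
        rw [add_sub_cancel_left, norm_smul, norm_norm, norm_eq_of_mem_sphere α, mul_one]
      rw [hfT t ht _ hne, hnorm] at h
      exact h
    have hS := sphereMean_deviation_eq_zero_of_nonpos hTt.continuousOn hr hleS
    -- apply at the direction of `y`
    set n : EuclideanSpace ℝ (Fin 3) := ‖y - x₀‖⁻¹ • (y - x₀) with hn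
    have hn1 : ‖n‖ = 1 := by rw [hn, norm_smul, norm_inv, norm_norm, inv_mul_cancel₀ hr]
    have hnS : n ∈ sphere (0 : EuclideanSpace ℝ (Fin 3)) 1 := by rw [mem_sphere_zero_iff_norm, hn1]
    have hyn : y = x₀ + ‖y - x₀‖ • n := by
      rw [hn, smul_smul, mul_inv_cancel₀ hr, one_smul]; abel
    have h := hS ⟨n, hnS⟩
    rw [← hyn] at h
    exact h
  exact cross_gradient_eq_zero_of_sphere_radial
    (g := fun r : ℝ => sphereIntegral volume (fun z => T t (x₀ + z)) r /
      ((volume : Measure (EuclideanSpace ℝ (Fin 3))).toSphere).real univ) hTd hzero x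

end ShellMean

end Summit.NavierStokesRegularity.NavierStokesRegularity.Theorems.PoloidalLiouville.Antidynamo
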